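import Summits.RiemannHypothesis.RiemannHypothesis.Theorems.UniversalFactorWideKernelNoGoStandalone
import Literature.Analysis.Complex.JensenCircles
import Literature.NumberTheory.LFunctions.DeBruijnNewmanProofs

/-!
# RiemannHypothesis / UniversalFactor — the Laguerre lift `LaguerreLift`, route-file-independent

Route `RiemannHypothesis/UniversalFactor`, item **`LaguerreLift`** (stmt-RiemannHypothesis-13911,
formerly stmt-RiemannHypothesis-2579): for every `a > 0`, if the Laplace-smoothed de Bruijn transform
`F_a(z) = ∫₀^∞ Φ(u)(1 + u²/a²)⁻¹cos(zu)du = deBruijnHDiv (fun u ↦ 1 + u²/a²) z` has only real zeros,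
then so has `H_0 = deBruijnH 0 = (1 − D²/a²)F_a` (`= ξ(1/2 + iz/2)/8`).

The item is PROVED in the tree by `UniversalFactor.laguerreLift`
(`UniversalFactorLaguerreLift.lean`, with the public lemmas `UniversalFactor.laguerre_step`,
`UniversalFactor.exists_growth_deriv_add_mul`, …), but that module imports the route file
`Summits.RiemannHypothesis.RiemannHypothesis.Theses.UniversalFactor`, and the gate links a closed item
as `import <proving module>` + `theorem LaguerreLift_holds` INTO the route file — an import cycle
(route revs 3/5, 2026-08-15/16; see `UniversalFactorH0DecayStandalone.lean`). This module imports
neither the route file nor any module importing it, and its single theorem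
`UniversalFactorStandalone.laguerreLift` states the BODY of the route decl verbatim, so the item can
be closed `--by` it (the same device as `UniversalFactorStandalone.wideKernelNoGo` for
`WideKernelNoGo`). To avoid a second public copy of the lemmas of `UniversalFactorLaguerreLift.lean`,
the two ingredients are kept LOCAL to the proof:

* Laguerre's step, Hadamard-free: for `f` real entire with `‖f(z)‖ ≤ C e^{‖z‖^ρ}` (`0 ≤ ρ < 2`) and
  only real zeros, and `c` real, `f' + c f` is `≡ 0` or has only real zeros — at a non-real `z`
  with `f(a) = 0` somewhere, `(Im z)·Im (f'/f)(z) ≤ −(Im z)²/‖z − a‖² < 0` (`im_mul_im_logDeriv_le`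
  of `Literature/Analysis/Complex/LaguerrePolya.lean`), so `f'/f(z) ≠ −c`; a zero-free such `f`
  has `f'/f + c` real-valued entire (`im_logDeriv_eq_zero_of_forall_ne_zero`), hence constant
  (open mapping theorem);
* growth bookkeeping: `F = F_a` has order `≤ 3/2`
  (`UniversalFactorStandalone.exists_growth_deBruijnHDiv_laplace`), so `G = F' + aF` has
  `‖G(z)‖ ≤ C' e^{‖z‖^{7/4}}` (Cauchy's estimate `norm_deriv_le_of_growth`).

Then `G' − aG = F'' − a²F = −a²H_0` (`deBruijnHDiv_laplace_sub_deriv_deriv`); two Laguerre steps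
`(F, a)`, `(G, −a)`, the degenerate alternatives being excluded by `H_0 ≢ 0`
(`exists_deBruijnH_ne_zero`).

References: E. Laguerre, Œuvres I, pp. 167–180 (closure of the Laguerre–Pólya class under `D + c`);
N. G. de Bruijn, Duke Math. J. 17 (1950), §1 and Thm. 10; D. A. Cardon, Proc. AMS 130 (2002), §3 Q. 7;
E. C. Titchmarsh, *The theory of the Riemann zeta-function* (1986), §10.1.
-/

noncomputable section

namespace Summit.RiemannHypothesis.RiemannHypothesis.Theorems

open MeasureTheory Set Filter
open Literature.NumberTheory.LFunctions Literature.Analysis.Complex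

/-- **`LaguerreLift`** (the body of the route decl, verbatim; item stmt-RiemannHypothesis-13911): for
every `a > 0`, if `F_a = deBruijnHDiv (fun u ↦ 1 + u²/a²)` has only real zeros then so has
`H_0 = deBruijnH 0`. With `F = F_a` (real entire of order `≤ 3/2 < 2`) put `G = F' + aF`; then
`G' − aG = F'' − a²F = −a² H_0` (`deBruijnHDiv_laplace_sub_deriv_deriv`). Laguerre's step (proved
locally, Hadamard-free, from `im_mul_im_logDeriv_le` / `im_logDeriv_eq_zero_of_forall_ne_zero`) for
`(F, a)` gives `G ≡ 0` or `G` real-rooted, and for `(G, −a)` gives `G' − aG ≡ 0` or real-rooted;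
both degenerate cases would force `H_0 ≡ 0`, contradicting `exists_deBruijnH_ne_zero`. Same
mathematics as `UniversalFactor.laguerreLift` (`UniversalFactorLaguerreLift.lean`), restated in a
module that does not import the route file. [folklore] -/
theorem UniversalFactorStandalone.laguerreLift :
    ∀ a : ℝ, 0 < a → Literature.NumberTheory.LFunctions.HasOnlyRealZeros
      (Literature.NumberTheory.LFunctions.deBruijnHDiv (fun u : ℝ => 1 + u ^ 2 / a ^ 2)) →
      Literature.NumberTheory.LFunctions.HasOnlyRealZeros (Literature.NumberTheory.LFunctions.deBruijnH 0) := by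
  /- (1) A real-valued entire function is constant (open mapping theorem). -/
  have hconst : ∀ (g : ℂ → ℂ), Differentiable ℂ g → (∀ z, (g z).im = 0) → ∀ z w, g z = g w := by
    intro g hg him z w
    have hga : AnalyticOnNhd ℂ g univ := hg.differentiableOn.analyticOnNhd isOpen_univ
    rcases hga.is_constant_or_isOpenMap with ⟨c, hc⟩ | hopen
    · rw [hc z, hc w]
    · exfalso
      have hU : IsOpen (g '' univ) := by simpa using hopen univ isOpen_univ
      obtain ⟨δ, hδ, hball⟩ := Metric.isOpen_iff.1 hU (g 0) ⟨0, mem_univ _, rfl⟩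
      have hmem : g 0 + Complex.I * (δ / 2 : ℝ) ∈ Metric.ball (g 0) δ := by
        rw [Metric.mem_ball, dist_eq_norm]
        have : ‖Complex.I * ((δ / 2 : ℝ) : ℂ)‖ = δ / 2 := by
          rw [norm_mul, Complex.norm_I, one_mul, Complex.norm_real, Real.norm_eq_abs,
            abs_of_pos (by positivity)]
        simp only [add_sub_cancel_left, this]
        linarith
      obtain ⟨u, -, hu⟩ := hball hmem
      have := him u
      rw [hu] at this
      simp [him 0] at this
      exact hδ.ne' this
  /- (2) Laguerre's step, Hadamard-free: `f' + c f` is `≡ 0` or has only real zeros. -/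
  have hstep : ∀ (f : ℂ → ℂ) (ρ C c : ℝ), Differentiable ℂ f → 0 ≤ ρ → ρ < 2 →
      (∀ z, ‖f z‖ ≤ C * Real.exp (‖z‖ ^ ρ)) → (∀ x : ℝ, (f x).im = 0) →
      (∀ z, f z = 0 → z.im = 0) →
      (∀ z, deriv f z + c * f z = 0) ∨ (∀ z, deriv f z + c * f z = 0 → z.im = 0) := by
    intro f ρ C c hf hρ0 hρ hgr hreal hzero
    by_cases hex : ∃ a, f a = 0
    · obtain ⟨a, ha⟩ := hex
      refine Or.inr fun z hz ↦ ?_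
      by_contra hzim
      have hfz : f z ≠ 0 := fun h ↦ hzim (hzero z h)
      have hq : deriv f z / f z = -(c : ℂ) := by
        rw [div_eq_iff hfz]; linear_combination hz
      have him : (deriv f z / f z).im = 0 := by rw [hq]; simp
      have key := im_mul_im_logDeriv_le hf hρ0 hρ hgr hreal hzero hzim ha
      rw [him, mul_zero] at key
      have hza : z - a ≠ 0 := by
        intro h
        apply hzim
        rw [sub_eq_zero.1 h]
        exact hzero a ha
      have h1 : 0 < z.im ^ 2 := by positivity
      have h2 : 0 < ‖z - a‖ ^ 2 := by positivity
      have hpos : 0 < z.im ^ 2 / ‖z - a‖ ^ 2 := div_pos h1 h2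
      linarith
    · push Not at hex
      set g : ℂ → ℂ := fun z ↦ deriv f z / f z + c with hg
      have hgd : Differentiable ℂ g := fun z ↦ ((hf.deriv z).div (hf z) (hex z)).add_const _
      have him : ∀ z, (g z).im = 0 := fun z ↦ by
        simp only [hg, Complex.add_im, Complex.ofReal_im, add_zero]
        exact im_logDeriv_eq_zero_of_forall_ne_zero hf hρ0 hρ hgr hreal hex z
      have hfg : ∀ z, deriv f z + c * f z = f z * g z := fun z ↦ by
        simp only [hg]
        field_simp [hex z]
      by_cases hg0 : ∃ w, g w = 0
      · obtain ⟨w, hw⟩ := hg0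
        refine Or.inl fun z ↦ ?_
        rw [hfg, hconst g hgd him z w, hw, mul_zero]
      · push Not at hg0
        refine Or.inr fun z hz ↦ ?_
        rw [hfg] at hz
        rcases mul_eq_zero.1 hz with h | h
        · exact absurd h (hex z)
        · exact absurd h (hg0 z)
  /- (3) The lift. -/
  intro a ha hFa
  set m : ℝ → ℝ := fun u => 1 + u ^ 2 / a ^ 2 with hm
  set F : ℂ → ℂ := deBruijnHDiv m with hFdef
  have hzero : ∀ z, F z = 0 → z.im = 0 := hFa
  have hFd : Differentiable ℂ F := differentiable_deBruijnHDiv_laplace a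
  have hFreal : ∀ x : ℝ, (F x).im = 0 := fun x ↦ deBruijnHDiv_ofReal_im m x
  obtain ⟨C, hgr⟩ := UniversalFactorStandalone.exists_growth_deBruijnHDiv_laplace a
  have hρ0 : (0 : ℝ) ≤ 3 / 2 := by norm_num
  have hρ : (3 / 2 : ℝ) < 2 := by norm_num
  have hC : 0 ≤ C := growthConst_nonneg hgr
  -- the intermediate function `G = F' + aF`
  set G : ℂ → ℂ := fun z ↦ deriv F z + (a : ℂ) * F z with hGdef
  have hFd' : Differentiable ℂ (deriv F) := hFd.deriv
  have hGd : Differentiable ℂ G := hFd'.add (hFd.const_mul _)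
  have hderivG : ∀ z, deriv G z = deriv (deriv F) z + (a : ℂ) * deriv F z := fun z ↦ by
    have h := ((hFd' z).hasDerivAt).add (((hFd z).hasDerivAt).const_mul (a : ℂ))
    exact h.deriv
  -- growth of `G`: exponent `7/4 = (3/2 + 2)/2`
  obtain ⟨C₁, h₁⟩ := norm_deriv_le_of_growth hFd hρ0 hρ hgr
  have hρ'0 : (0 : ℝ) ≤ (3 / 2 + 2) / 2 := by norm_num
  have hρ' : ((3 / 2 + 2) / 2 : ℝ) < 2 := by norm_num
  have hgr' : ∀ z, ‖G z‖ ≤ (C₁ + a * C * Real.exp 1) * Real.exp (‖z‖ ^ ((3 / 2 + 2) / 2 : ℝ)) := by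
    intro z
    have hexp : Real.exp (‖z‖ ^ (3 / 2 : ℝ)) ≤
        Real.exp 1 * Real.exp (‖z‖ ^ ((3 / 2 + 2) / 2 : ℝ)) := by
      rw [← Real.exp_add]
      apply Real.exp_le_exp.2
      have h0 : 0 ≤ ‖z‖ ^ ((3 / 2 + 2) / 2 : ℝ) := Real.rpow_nonneg (norm_nonneg z) _
      rcases le_or_gt 1 ‖z‖ with h | h
      · have := Real.rpow_le_rpow_of_exponent_le h (by norm_num : (3 / 2 : ℝ) ≤ (3 / 2 + 2) / 2)
        linarith
      · have := Real.rpow_le_one (norm_nonneg z) h.le hρ0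
        linarith
    have hFz : ‖(a : ℂ) * F z‖ ≤ a * C * (Real.exp 1 * Real.exp (‖z‖ ^ ((3 / 2 + 2) / 2 : ℝ))) := by
      rw [norm_mul, Complex.norm_real, Real.norm_eq_abs, abs_of_pos ha, mul_assoc]
      exact mul_le_mul_of_nonneg_left ((hgr z).trans (mul_le_mul_of_nonneg_left hexp hC)) ha.le
    calc ‖G z‖ ≤ ‖deriv F z‖ + ‖(a : ℂ) * F z‖ := norm_add_le _ _
      _ ≤ C₁ * Real.exp (‖z‖ ^ ((3 / 2 + 2) / 2 : ℝ)) +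
            a * C * (Real.exp 1 * Real.exp (‖z‖ ^ ((3 / 2 + 2) / 2 : ℝ))) := add_le_add (h₁ z) hFz
      _ = (C₁ + a * C * Real.exp 1) * Real.exp (‖z‖ ^ ((3 / 2 + 2) / 2 : ℝ)) := by ring
  -- the ODE `F − F''/a² = H_0`, rewritten as `H_0 = −(G' − aG)/a²`
  have hODE : ∀ z, F z - deriv (deriv F) z / (a : ℂ) ^ 2 = deBruijnH 0 z := fun z ↦
    deBruijnHDiv_laplace_sub_deriv_deriv a z
  have ha0 : (a : ℂ) ≠ 0 := by exact_mod_cast ha.ne'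
  have hH : ∀ z, deBruijnH 0 z = -(deriv G z + (-(a : ℝ) : ℝ) * G z) / (a : ℂ) ^ 2 := by
    intro z
    rw [← hODE z, hderivG]
    simp only [hGdef]
    push_cast
    field_simp
    ring
  obtain ⟨z₁, hz₁⟩ := exists_deBruijnH_ne_zero 0
  have hGreal : ∀ x : ℝ, (G x).im = 0 := fun x ↦ by
    simp only [hGdef, Complex.add_im, Complex.mul_im, Complex.ofReal_re, Complex.ofReal_im,
      zero_mul, add_zero, im_deriv_ofReal hFd hFreal x, hFreal x, mul_zero]
  rcases hstep F (3 / 2) C a hFd hρ0 hρ hgr hFreal hzero with hG0 | hGz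
  · -- `G ≡ 0` would give `H_0 ≡ 0`
    exfalso
    apply hz₁
    have hG0' : G = 0 := funext hG0
    rw [hH, hG0']
    simp
  · rcases hstep G ((3 / 2 + 2) / 2) (C₁ + a * C * Real.exp 1) (-a) hGd hρ'0 hρ' hgr' hGreal hGz
      with hK0 | hKz
    · -- `G' − aG ≡ 0` would give `H_0 ≡ 0`
      exfalso
      apply hz₁
      rw [hH, hK0]
      simp
    · intro z hz
      refine hKz z ?_
      have h := hH z
      rw [hz] at h
      have ha2 : (a : ℂ) ^ 2 ≠ 0 := pow_ne_zero 2 ha0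
      have := (div_eq_zero_iff.1 h.symm).resolve_right ha2
      exact neg_eq_zero.1 this

end Summit.RiemannHypothesis.RiemannHypothesis.Theorems
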